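import Literature.Analysis.ODE.ComplexSecondOrder
import Literature.Analysis.ODE.ComplexOverRealBasis
import Mathlib.Analysis.SpecialFunctions.Complex.Circle
import Mathlib.Analysis.SpecialFunctions.Complex.Arg
import HarnessLib

/-!
# Stationary scattering on the line at real energy: Jost solutions, the coefficients
# `a(ω)`, `b(ω)`, transmission / reflection coefficients, unitarity, the reflection phase

Topic `Literature/Analysis/ODE` (namespace `Literature.Analysis.ODE.Scattering1D`).  The REAL-ENERGY
vocabulary of one-dimensional scattering for `−f″ + V f = ω² f` on `ℝ` (`V` real, `ω ≠ 0` real;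
Marchenko, *Sturm–Liouville Operators and Applications*, Ch. 3 §5, eqs. (3.5.1)–(3.5.9);
Deift–Trubowitz, *Inverse scattering on the line*, §2), in the tree's language of solution pairs
`(f, f′)` (`IsSol2` and `wronskian` of `ComplexSecondOrder.lean`, `W(y, z) = y z′ − y′ z`):

* `IsRightJost V ω f f′` — `f″ = (V − ω²) f` on `ℝ` and `e^{−iωx} f(x) → 1`, `e^{−iωx} f′(x) → iω` as
  `x → +∞` (`f ~ e^{iωx}`: Marchenko's `e⁺(λ, x)`, Deift–Trubowitz's `f₁(x, k)`, `λ = k = ω`);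
  `IsLeftJost V ω g g′` — the same with `e^{iωx} g → 1`, `e^{iωx} g′ → −iω` as `x → −∞`
  (`g ~ e^{−iωx}`: Marchenko's `e⁻(−λ, x)`, Deift–Trubowitz's `f₂(x, k)`).
  API: the complex conjugate is the Jost solution at `−ω` (`IsRightJost.conj`, `IsLeftJost.conj` —
  for a real potential `e(−λ, x) = conj e(λ, x)`), and the conserved fluxes are
  `Im(f̄ f′) ≡ ω`, `Im(ḡ g′) ≡ −ω` (`IsRightJost.flux_eq`, `IsLeftJost.flux_eq`).
* For a Jost pair `(f₊, f₋)` (written `fp, fm` in the code) at `ω`: Marchenko's `a(ω) = W(f₋, f₊)(0)/(2iω)` and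
  `b(ω) = W(f₊, f̄₋)(0)/(2iω)` (`jostA`, `jostB`; (3.5.5)–(3.5.6) — Marchenko's bracket is
  `W{φ, ψ} = φ′ψ − φψ′ = W(ψ, φ)`), the **transmission coefficient** `T = 1/a = 2iω/W(f₋, f₊)(0)`, the
  **left / right reflection coefficients** `R₋ = b/a = W(f₊, f̄₋)(0)/W(f₋, f₊)(0)` and
  `R₊ = −b(−ω)/a(ω) = W(f̄₊, f₋)(0)/W(f₋, f₊)(0)` ((3.5.9); the right scattering eigenfunction
  `T f₋ ~ e^{−iωx} + R₊ e^{iωx}` at `+∞`, the left one `T f₊ ~ e^{iωx} + R₋ e^{−iωx}` at `−∞`).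
  Unitarity `|a|² = 1 + |b|²`, `‖T‖² + ‖R±‖² = 1` (3.5.7) and the scattering eigenfunction identities
  `T f₋ = f̄₊ + R₊ f₊`, `T f₊ = f̄₋ + R₋ f₋` (3.5.8)–(3.5.8′) are PROVED in `JostScatteringUnitarity1D.lean`
  from the two fluxes, with no integrability hypothesis on `V` (those enter only the EXISTENCE of
  Jost solutions, which is not asserted).
* `IsReflectionPhase R θ :↔ R = ‖R‖·e^{2iθ}` — a **reflection (standing-wave) phase**: when
  `R₊ = |R₊| e^{2iθ}`, `e^{−iθ} T f₋ ~ e^{−i(ωx+θ)} + |R₊| e^{i(ωx+θ)}`, whose real part is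
  `(1 + |R₊|) cos(ωx + θ)`; the principal choice `arg R / 2` is one (`isReflectionPhase_arg_div_two`).
  Continuous branches `θ(ω)` are chosen by the user (the predicate is what statements quantify).

Deliberately NOT here: existence / uniqueness / continuity in `ω` of Jost solutions (Volterra
equations, Marchenko Lemma 3.1.1, Deift–Trubowitz §2 Lemma 1 — a theorem for a later file; for a
potential that is merely integrable near the respective end, e.g. the inverse-square tail
`ℓ(ℓ+1)/x²` of the Regge–Wheeler potentials, the normalisation above still singles out one solution
at each fixed `ω ≠ 0`), bound states and `a(λ)` in the upper half-plane, the Marchenko equation,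
low-frequency asymptotics of the phase.  The radiation-field / distorted-Fourier side of the
vocabulary is `RadiationField1D.lean`.

## References
* V. A. Marchenko, *Sturm–Liouville Operators and Applications*, AMS Chelsea (2011), Ch. 3 §5,
  (3.5.1)–(3.5.9). Key `Marchenko2011`.
* P. Deift, E. Trubowitz, Comm. Pure Appl. Math. 32 (1979) 121–251, §2. Key `DeiftTrubowitz1979`.
* E. C. Titchmarsh, *Eigenfunction Expansions I* (1962), §5.3 (the flux `Im(ū u′)`); folklore.
-/

noncomputable section

open Set Filter
open scoped Topology ComplexConjugate

namespace Literature.Analysis.ODE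

namespace Scattering1D

open _root_.Complex (I exp arg)

/-! ### Jost solutions at real frequency -/

/-- **Right Jost solution** of `−f″ + V f = ω² f` at the real frequency `ω`: the pair `(f, f′)`
solves `f″ = (V − ω²) f` on all of `ℝ` (`IsSol2` on `univ`) and is normalised at `+∞` by
`e^{−iωx} f(x) → 1`, `e^{−iωx} f′(x) → iω` (so `f(x) ~ e^{iωx}`).  Marchenko's `e⁺(λ, x)`,
Deift–Trubowitz's `f₁(x, k)` (`λ = k = ω`). [cite: Marchenko2011, Ch. 3 §5 (3.5.3)] -/
structure IsRightJost (V : ℝ → ℝ) (ω : ℝ) (f f' : ℝ → ℂ) : Prop where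
  isSol2 : IsSol2 (fun x ↦ ((V x - ω ^ 2 : ℝ) : ℂ)) f f' univ
  tendsto : Tendsto (fun x : ℝ ↦ exp (-((ω * x : ℝ) : ℂ) * I) * f x) atTop (𝓝 1)
  tendsto_deriv : Tendsto (fun x : ℝ ↦ exp (-((ω * x : ℝ) : ℂ) * I) * f' x) atTop (𝓝 ((ω : ℂ) * I))

/-- **Left Jost solution** of `−g″ + V g = ω² g` at the real frequency `ω`: `g″ = (V − ω²) g` on `ℝ`
and `e^{iωx} g(x) → 1`, `e^{iωx} g′(x) → −iω` as `x → −∞` (so `g(x) ~ e^{−iωx}`).  Marchenko's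
`e⁻(−λ, x)`, Deift–Trubowitz's `f₂(x, k)`. [cite: Marchenko2011, Ch. 3 §5 (3.5.3)] -/
structure IsLeftJost (V : ℝ → ℝ) (ω : ℝ) (g g' : ℝ → ℂ) : Prop where
  isSol2 : IsSol2 (fun x ↦ ((V x - ω ^ 2 : ℝ) : ℂ)) g g' univ
  tendsto : Tendsto (fun x : ℝ ↦ exp (((ω * x : ℝ) : ℂ) * I) * g x) atBot (𝓝 1)
  tendsto_deriv : Tendsto (fun x : ℝ ↦ exp (((ω * x : ℝ) : ℂ) * I) * g' x) atBot (𝓝 (-((ω : ℂ) * I)))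

variable {V : ℝ → ℝ} {ω : ℝ} {f f' g g' : ℝ → ℂ}

/-- `conj (e^{i s}) = e^{−i s}` for real `s`. [folklore] -/
theorem conj_exp_ofReal_mul_I (s : ℝ) : conj (exp ((s : ℂ) * I)) = exp (-(s : ℂ) * I) := by
  rw [← Complex.exp_conj, map_mul, Complex.conj_ofReal, Complex.conj_I]
  ring_nf

/-- `e^{i s} · e^{−i s} = 1` for real `s`, in the form `conj(e^{−is}) · e^{−is} = 1`. [folklore] -/
theorem conj_exp_neg_mul_self (s : ℝ) : conj (exp (-(s : ℂ) * I)) * exp (-(s : ℂ) * I) = 1 := by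
  have h : conj (exp (-(s : ℂ) * I)) = exp ((s : ℂ) * I) := by
    rw [← Complex.exp_conj, map_mul, map_neg, Complex.conj_ofReal, Complex.conj_I]
    ring_nf
  rw [h, ← Complex.exp_add]
  simp

/-- `conj(e^{is}) · e^{is} = 1` for real `s`. [folklore] -/
theorem conj_exp_mul_self (s : ℝ) : conj (exp ((s : ℂ) * I)) * exp ((s : ℂ) * I) = 1 := by
  rw [conj_exp_ofReal_mul_I, ← Complex.exp_add]
  simp

/-- The solution predicate for the real coefficient `V − ω²` is invariant under complex conjugation
of the pair. [folklore] -/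
theorem isSol2_conj (h : IsSol2 (fun x ↦ ((V x - ω ^ 2 : ℝ) : ℂ)) f f' univ) :
    IsSol2 (fun x ↦ ((V x - ω ^ 2 : ℝ) : ℂ)) (fun x ↦ conj (f x)) (fun x ↦ conj (f' x)) univ := by
  refine ⟨fun x _ ↦ (h.hasDerivAt x (mem_univ x)).star, fun x _ ↦ ?_⟩
  have h2 := (h.hasDerivAt_deriv x (mem_univ x)).star
  refine h2.congr_deriv ?_
  simp only [star_mul', Complex.star_def, Complex.conj_ofReal]

/-- **`e⁺(−λ, x) = conj e⁺(λ, x)`**: the conjugate of a right Jost solution at `ω` is a right Jost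
solution at `−ω` (the potential is real). [cite: Marchenko2011, Ch. 3 §5] -/
theorem IsRightJost.conj (h : IsRightJost V ω f f') :
    IsRightJost V (-ω) (fun x ↦ conj (f x)) (fun x ↦ conj (f' x)) where
  isSol2 := by
    have := isSol2_conj h.isSol2
    simpa only [even_two.neg_pow] using this
  tendsto := by
    have h1 := (Complex.continuous_conj.tendsto 1).comp h.tendsto
    rw [map_one] at h1
    refine h1.congr fun x ↦ ?_
    simp only [Function.comp_apply, map_mul, ← Complex.exp_conj, map_neg, Complex.conj_ofReal,
      Complex.conj_I]
    push_cast
    ring_nf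
  tendsto_deriv := by
    have h1 := (Complex.continuous_conj.tendsto ((ω : ℂ) * I)).comp h.tendsto_deriv
    have e : conj ((ω : ℂ) * I) = ((-ω : ℝ) : ℂ) * I := by
      simp only [map_mul, Complex.conj_ofReal, Complex.conj_I]; push_cast; ring
    rw [e] at h1
    refine h1.congr fun x ↦ ?_
    simp only [Function.comp_apply, map_mul, ← Complex.exp_conj, map_neg, Complex.conj_ofReal,
      Complex.conj_I]
    push_cast
    ring_nf

/-- **`e⁻(λ, x) = conj e⁻(−λ, x)`**: the conjugate of a left Jost solution at `ω` is a left Jost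
solution at `−ω`. [cite: Marchenko2011, Ch. 3 §5] -/
theorem IsLeftJost.conj (h : IsLeftJost V ω g g') :
    IsLeftJost V (-ω) (fun x ↦ conj (g x)) (fun x ↦ conj (g' x)) where
  isSol2 := by
    have := isSol2_conj h.isSol2
    simpa only [even_two.neg_pow] using this
  tendsto := by
    have h1 := (Complex.continuous_conj.tendsto 1).comp h.tendsto
    rw [map_one] at h1
    refine h1.congr fun x ↦ ?_
    simp only [Function.comp_apply, map_mul, ← Complex.exp_conj, Complex.conj_ofReal,
      Complex.conj_I]
    push_cast
    ring_nf
  tendsto_deriv := by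
    have h1 := (Complex.continuous_conj.tendsto (-((ω : ℂ) * I))).comp h.tendsto_deriv
    have e : conj (-((ω : ℂ) * I)) = -(((-ω : ℝ) : ℂ) * I) := by
      simp only [map_neg, map_mul, Complex.conj_ofReal, Complex.conj_I]; push_cast; ring
    rw [e] at h1
    refine h1.congr fun x ↦ ?_
    simp only [Function.comp_apply, map_mul, ← Complex.exp_conj, Complex.conj_ofReal,
      Complex.conj_I]
    push_cast
    ring_nf

/-! ### Conserved fluxes and Wronskians of global solutions -/

/-- The `Icc`-form of the solution hypothesis used by `ComplexOverRealBasis.lean`. [folklore] -/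
theorem hasDerivAt_pair_of_isSol2 (h : IsSol2 (fun x ↦ ((V x - ω ^ 2 : ℝ) : ℂ)) f f' univ)
    (α β : ℝ) : ∀ x ∈ Icc α β, HasDerivAt f (f' x) x ∧
      HasDerivAt f' (((fun y ↦ V y - ω ^ 2) x : ℂ) * f x) x :=
  fun x _ ↦ ⟨h.hasDerivAt x (mem_univ x), h.hasDerivAt_deriv x (mem_univ x)⟩

/-- **Flux conservation on the line**: `Im(conj f(x) · f′(x))` is independent of `x` for a global
solution pair of the real equation. [folklore] -/
theorem flux_eq_flux_zero (h : IsSol2 (fun x ↦ ((V x - ω ^ 2 : ℝ) : ℂ)) f f' univ) (x : ℝ) :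
    (conj (f x) * f' x).im = (conj (f 0) * f' 0).im := by
  rcases le_total 0 x with hx | hx
  · exact flux_const (hasDerivAt_pair_of_isSol2 h 0 x) ⟨hx, le_rfl⟩
  · exact (flux_const (hasDerivAt_pair_of_isSol2 h x 0) ⟨hx, le_rfl⟩).symm

/-- **The Wronskian of two global solution pairs is constant on `ℝ`.** [folklore] -/
theorem wronskian_eq_wronskian_zero {Q : ℝ → ℂ} {y y' z z' : ℝ → ℂ} (hy : IsSol2 Q y y' univ)
    (hz : IsSol2 Q z z' univ) (x : ℝ) : wronskian y y' z z' x = wronskian y y' z z' 0 := by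
  have hy' : IsSol2 Q y y' (Ioi (min x 0 - 1)) := hy.mono (subset_univ _)
  have hz' : IsSol2 Q z z' (Ioi (min x 0 - 1)) := hz.mono (subset_univ _)
  exact hy'.wronskian_eq hz' (by have := min_le_left x 0; linarith)
    (by have := min_le_right x 0; linarith)

/-- A function on `ℝ` that is constant and tends to `c` along `atTop` is identically `c`.
[folklore] -/
theorem eq_of_forall_eq_of_tendsto {E : Type*} [TopologicalSpace E] [T2Space E] {φ : ℝ → E}
    {c : E} (hconst : ∀ x, φ x = φ 0) {l : Filter ℝ} [l.NeBot] (h : Tendsto φ l (𝓝 c)) (x : ℝ) :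
    φ x = c := by
  have h' : Tendsto (fun _ : ℝ ↦ φ 0) l (𝓝 c) := h.congr fun y ↦ hconst y
  rw [hconst x]
  exact tendsto_nhds_unique tendsto_const_nhds h'

/-- **The flux of a right Jost solution is `ω`**: `Im(conj f(x) · f′(x)) = ω` for every `x`
(conserved, and `→ Im(1̄ · iω) = ω` at `+∞`). [cite: Marchenko2011, Ch. 3 §5] -/
theorem IsRightJost.flux_eq (h : IsRightJost V ω f f') (x : ℝ) : (conj (f x) * f' x).im = ω := by
  have hlim : Tendsto (fun y : ℝ ↦ (conj (f y) * f' y).im) atTop (𝓝 ω) := by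
    have h1 := ((Complex.continuous_conj.tendsto 1).comp h.tendsto).mul h.tendsto_deriv
    have h2 := (Complex.continuous_im.tendsto _).comp h1
    have e : (conj (1 : ℂ) * ((ω : ℂ) * I)).im = ω := by simp
    rw [e] at h2
    refine h2.congr fun y ↦ ?_
    simp only [Function.comp_apply, map_mul]
    have : conj (exp (-((ω * y : ℝ) : ℂ) * I)) * conj (f y) * (exp (-((ω * y : ℝ) : ℂ) * I) * f' y)
        = (conj (exp (-((ω * y : ℝ) : ℂ) * I)) * exp (-((ω * y : ℝ) : ℂ) * I)) * (conj (f y) * f' y) := by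
      ring
    rw [this, conj_exp_neg_mul_self, one_mul]
  exact eq_of_forall_eq_of_tendsto (φ := fun y ↦ (conj (f y) * f' y).im)
    (flux_eq_flux_zero h.isSol2) hlim x

/-- **The flux of a left Jost solution is `−ω`**: `Im(conj g(x) · g′(x)) = −ω` for every `x`.
[cite: Marchenko2011, Ch. 3 §5] -/
theorem IsLeftJost.flux_eq (h : IsLeftJost V ω g g') (x : ℝ) : (conj (g x) * g' x).im = -ω := by
  have hlim : Tendsto (fun y : ℝ ↦ (conj (g y) * g' y).im) atBot (𝓝 (-ω)) := by
    have h1 := ((Complex.continuous_conj.tendsto 1).comp h.tendsto).mul h.tendsto_deriv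
    have h2 := (Complex.continuous_im.tendsto _).comp h1
    have e : (conj (1 : ℂ) * -((ω : ℂ) * I)).im = -ω := by simp
    rw [e] at h2
    refine h2.congr fun y ↦ ?_
    simp only [Function.comp_apply, map_mul]
    have : conj (exp (((ω * y : ℝ) : ℂ) * I)) * conj (g y) * (exp (((ω * y : ℝ) : ℂ) * I) * g' y)
        = (conj (exp (((ω * y : ℝ) : ℂ) * I)) * exp (((ω * y : ℝ) : ℂ) * I)) * (conj (g y) * g' y) := by
      ring
    rw [this, conj_exp_mul_self, one_mul]
  exact eq_of_forall_eq_of_tendsto (φ := fun y ↦ (conj (g y) * g' y).im)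
    (flux_eq_flux_zero h.isSol2) hlim x

/-! ### The coefficients `a`, `b`, `T`, `R₋`, `R₊` of a Jost pair -/

/-- Marchenko's **`a(ω) = W{e⁺(λ,·), e⁻(−λ,·)}/(2iλ) = W(f₋, f₊)(0)/(2iω)`** for a Jost pair
`fp ~ e^{iωx}` (`+∞`), `fm ~ e^{−iωx}` (`−∞`); `1/a` is the transmission coefficient.
[cite: Marchenko2011, Ch. 3 §5 (3.5.5)] -/
def jostA (ω : ℝ) (fp fp' fm fm' : ℝ → ℂ) : ℂ :=
  wronskian fm fm' fp fp' 0 / (2 * (ω : ℂ) * I)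

/-- Marchenko's **`b(ω) = W{e⁻(λ,·), e⁺(λ,·)}/(2iλ) = W(f₊, f̄₋)(0)/(2iω)`** (`e⁻(λ,·) = conj f₋`
for a real potential); `b/a` is the left reflection coefficient.
[cite: Marchenko2011, Ch. 3 §5 (3.5.6)] -/
def jostB (ω : ℝ) (fp fp' fm fm' : ℝ → ℂ) : ℂ :=
  wronskian fp fp' (fun x ↦ conj (fm x)) (fun x ↦ conj (fm' x)) 0 / (2 * (ω : ℂ) * I)

/-- The **transmission coefficient** `T(ω) = 1/a(ω) = 2iω / W(f₋, f₊)(0)` of a Jost pair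
(`T fm ~ T e^{−iωx}` at `−∞`, `T fp ~ T e^{iωx}` at `+∞`).  Junk value `0` when the Wronskian
vanishes (it never does for a genuine Jost pair at `ω ≠ 0`: `wronskian_ne_zero` in
`JostScatteringUnitarity1D.lean`).
[cite: Marchenko2011, Ch. 3 §5 (3.5.9)] -/
def transmissionCoeff (ω : ℝ) (fp fp' fm fm' : ℝ → ℂ) : ℂ :=
  2 * (ω : ℂ) * I / wronskian fm fm' fp fp' 0

/-- The **left reflection coefficient** `R₋(ω) = b(ω)/a(ω) = W(f₊, f̄₋)(0)/W(f₋, f₊)(0)`: the left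
scattering eigenfunction is `T fp = e⁻(λ,·) + R₋ e⁻(−λ,·) ~ e^{iωx} + R₋ e^{−iωx}` at `−∞`.
[cite: Marchenko2011, Ch. 3 §5 (3.5.8)–(3.5.9)] -/
def reflectionLeft (fp fp' fm fm' : ℝ → ℂ) : ℂ :=
  wronskian fp fp' (fun x ↦ conj (fm x)) (fun x ↦ conj (fm' x)) 0 / wronskian fm fm' fp fp' 0

/-- The **right reflection coefficient** `R₊(ω) = −b(−ω)/a(ω) = W(f̄₊, f₋)(0)/W(f₋, f₊)(0)`: the
right scattering eigenfunction is `T fm = e⁺(−λ,·) + R₊ e⁺(λ,·) ~ e^{−iωx} + R₊ e^{iωx}` at `+∞`.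
[cite: Marchenko2011, Ch. 3 §5 (3.5.8′)–(3.5.9)] -/
def reflectionRight (fp fp' fm fm' : ℝ → ℂ) : ℂ :=
  wronskian (fun x ↦ conj (fp x)) (fun x ↦ conj (fp' x)) fm fm' 0 / wronskian fm fm' fp fp' 0

variable {fp fp' fm fm' : ℝ → ℂ}

/-- `T = 1/a`. [cite: Marchenko2011, Ch. 3 §5 (3.5.9)] -/
theorem transmissionCoeff_eq_inv_jostA (ω : ℝ) (fp fp' fm fm' : ℝ → ℂ) :
    transmissionCoeff ω fp fp' fm fm' = (jostA ω fp fp' fm fm')⁻¹ := by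
  rw [transmissionCoeff, jostA, inv_div]

/-- `R₋ = b/a` (for `ω ≠ 0`). [cite: Marchenko2011, Ch. 3 §5 (3.5.9)] -/
theorem reflectionLeft_eq_jostB_div_jostA (hω : ω ≠ 0) (fp fp' fm fm' : ℝ → ℂ) :
    reflectionLeft fp fp' fm fm' = jostB ω fp fp' fm fm' / jostA ω fp fp' fm fm' := by
  have h2 : (2 * (ω : ℂ) * I) ≠ 0 :=
    mul_ne_zero (mul_ne_zero two_ne_zero (Complex.ofReal_ne_zero.2 hω)) Complex.I_ne_zero
  rw [reflectionLeft, jostB, jostA, div_div_div_cancel_right₀ h2]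

/-! ### The reflection (standing-wave) phase -/

/-- `θ` is a **reflection phase** of the complex number `R`: `R = |R|·e^{2iθ}`.  For `R = R₊(ω)` this
is the standing-wave phase at `+∞`: `e^{−iθ}(e^{−iωx} + R₊ e^{iωx}) = (1 + |R₊|) cos(ωx + θ) −
i (1 − |R₊|) sin(ωx + θ)`; it is determined modulo `π` when `R ≠ 0`. [folklore] -/
def IsReflectionPhase (R : ℂ) (θ : ℝ) : Prop := R = (‖R‖ : ℂ) * exp (2 * (θ : ℂ) * I)

/-- The principal value `arg R / 2 ∈ (−π/2, π/2]` is a reflection phase. [folklore] -/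
theorem isReflectionPhase_arg_div_two (R : ℂ) : IsReflectionPhase R (arg R / 2) := by
  unfold IsReflectionPhase
  have e : 2 * ((arg R / 2 : ℝ) : ℂ) * I = arg R * I := by push_cast; ring
  rw [e]
  exact (Complex.norm_mul_exp_arg_mul_I R).symm

/-- Reflection phases are defined modulo `π`. [folklore] -/
theorem IsReflectionPhase.add_int_mul_pi {R : ℂ} {θ : ℝ} (h : IsReflectionPhase R θ) (n : ℤ) :
    IsReflectionPhase R (θ + n * Real.pi) := by
  unfold IsReflectionPhase at h ⊢
  have e : 2 * ((θ + n * Real.pi : ℝ) : ℂ) * I = 2 * (θ : ℂ) * I + n * (2 * Real.pi * I) := by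
    push_cast; ring
  rw [e, Complex.exp_add, Complex.exp_int_mul_two_pi_mul_I, mul_one]
  exact h

/-- **The standing wave**: if `R = |R| e^{2iθ}` then, for all real `ω, x`,
`e^{−iθ}(e^{−iωx} + R e^{iωx}) = (1 + |R|) cos(ωx + θ) − i (1 − |R|) sin(ωx + θ)` — the real part
of the phase-rotated right scattering asymptotics is the standing wave `(1 + |R|) cos(ωx + θ)`.
[folklore] -/
theorem IsReflectionPhase.standingWave {R : ℂ} {θ : ℝ} (h : IsReflectionPhase R θ) (ω x : ℝ) :
    exp (-(θ : ℂ) * I) * (exp (-((ω * x : ℝ) : ℂ) * I) + R * exp (((ω * x : ℝ) : ℂ) * I)) =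
      (1 + ‖R‖ : ℂ) * Complex.cos ((ω * x + θ : ℝ) : ℂ) -
        (1 - ‖R‖ : ℂ) * Complex.sin ((ω * x + θ : ℝ) : ℂ) * I := by
  have e1 : exp (-(θ : ℂ) * I) * exp (-((ω * x : ℝ) : ℂ) * I) = exp (-((ω * x + θ : ℝ) : ℂ) * I) := by
    rw [← Complex.exp_add]
    congr 1
    push_cast
    ring
  have e2 : exp (-(θ : ℂ) * I) * exp (2 * (θ : ℂ) * I) * exp (((ω * x : ℝ) : ℂ) * I) =
      exp (((ω * x + θ : ℝ) : ℂ) * I) := by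
    rw [← Complex.exp_add, ← Complex.exp_add]
    congr 1
    push_cast
    ring
  have h1 : exp (-(θ : ℂ) * I) * (exp (-((ω * x : ℝ) : ℂ) * I) + R * exp (((ω * x : ℝ) : ℂ) * I)) =
      exp (-((ω * x + θ : ℝ) : ℂ) * I) + (‖R‖ : ℂ) * exp (((ω * x + θ : ℝ) : ℂ) * I) := by
    conv_lhs => rw [h]
    linear_combination e1 + (‖R‖ : ℂ) * e2
  rw [h1]
  unfold Complex.cos Complex.sin
  have hI : I * I = -1 := Complex.I_mul_I
  linear_combination ((1 - (‖R‖ : ℂ)) * (exp (-((ω * x + θ : ℝ) : ℂ) * I) -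
    exp (((ω * x + θ : ℝ) : ℂ) * I)) / 2) * hI

/-! ### Jost families over the positive frequency axis -/

/-- A **Jost family** for the potential `V`: for every `ω > 0` a right Jost pair
`(fp ω, fp' ω) ~ e^{iωx}` at `+∞` and a left Jost pair `(fm ω, fm' ω) ~ e^{−iωx}` at `−∞` (values at
`ω ≤ 0` are unconstrained).  Existence (Volterra equations) and uniqueness are theorems about `V`, not
recorded here; statements quantify over families. [cite: Marchenko2011, Ch. 3 §5 (3.5.3)] -/
structure JostFamily (V : ℝ → ℝ) where
  /-- the right Jost solutions `fp ω ~ e^{iωx}` at `+∞` -/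
  fp : ℝ → ℝ → ℂ
  /-- their derivatives in `x` -/
  fp' : ℝ → ℝ → ℂ
  /-- the left Jost solutions `fm ω ~ e^{−iωx}` at `−∞` -/
  fm : ℝ → ℝ → ℂ
  /-- their derivatives in `x` -/
  fm' : ℝ → ℝ → ℂ
  isRightJost : ∀ ω, 0 < ω → IsRightJost V ω (fp ω) (fp' ω)
  isLeftJost : ∀ ω, 0 < ω → IsLeftJost V ω (fm ω) (fm' ω)

namespace JostFamily

variable (J : JostFamily V)

/-- The transmission coefficient `T(ω)` of a Jost family. [cite: Marchenko2011, Ch. 3 §5 (3.5.9)] -/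
def T (ω : ℝ) : ℂ := transmissionCoeff ω (J.fp ω) (J.fp' ω) (J.fm ω) (J.fm' ω)

/-- The right reflection coefficient `R₊(ω)` of a Jost family. [cite: Marchenko2011, Ch. 3 §5 (3.5.9)] -/
def Rright (ω : ℝ) : ℂ := reflectionRight (J.fp ω) (J.fp' ω) (J.fm ω) (J.fm' ω)

/-- The left reflection coefficient `R₋(ω)` of a Jost family. [cite: Marchenko2011, Ch. 3 §5 (3.5.9)] -/
def Rleft (ω : ℝ) : ℂ := reflectionLeft (J.fp ω) (J.fp' ω) (J.fm ω) (J.fm' ω)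

/-- `θ : ℝ → ℝ` is a **(right) reflection-phase function** of the family on `(0, ∞)`:
`R₊(ω) = |R₊(ω)| e^{2iθ(ω)}` for every `ω > 0` (any branch; continuity / differentiability of the
branch is for the user to require). [folklore] -/
def IsPhase (θ : ℝ → ℝ) : Prop := ∀ ω, 0 < ω → IsReflectionPhase (J.Rright ω) (θ ω)

/-- The principal branch `ω ↦ arg R₊(ω) / 2` is a reflection-phase function. [folklore] -/
theorem isPhase_arg_div_two : J.IsPhase fun ω ↦ arg (J.Rright ω) / 2 :=
  fun ω _ ↦ isReflectionPhase_arg_div_two (J.Rright ω)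

end JostFamily

end Scattering1D

end Literature.Analysis.ODE
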